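import Mathlib
import Summits.CriticalPhenomena.CardyFormulaZ2.Theorems.CardySelfRefinementDefs
import Summits.CriticalPhenomena.CardyFormulaZ2.Theorems.CardySelfRefinementGradientComparabilityStubSlopeBoundsCornerTransferReroute
import HarnessLib

/-!
# Crux `GradientComparability` (stmt-CriticalPhenomena-10269), line `monotone-product-coordinates` —
# stub `stub_cornerLocalSlope` (LOC), corner transfer (B″₂), part 2: the `k = 2` cell and the
# pointwise corner transfer — a pivotal spoke makes a side bundle set-pivotal after tying at most
# three sides

Route `CardySelfRefinement`, sub-problem `CriticalPhenomena/CardyFormulaZ2`; vocabulary from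
`CardySelfRefinementDefs` (`ax tb Aloc edgeOf dirVec`); part 1 (`…StubSlopeBoundsCornerTransferReroute`:
`exists_adj_mem_of_isPivotal`, `mem_Aloc_of_local_patch`, `setPivotal_chain4`) and the frame kit of
`…StubNonAxialShareBulkFrames` (`frame_adj`, `frame_neighbours`, `frame_coord_le`,
`isPreconnected_openEdgeUnion_insert`, `meshPoint_mem_openEdgeUnion`).

## Mathematics

For `k = 2` the coarse cell of base `z ∈ ℤ²` has centre `w = 2z + (1,1)`; its four interior
(non-axial) edges are the spokes `{w, μ}` to the midpoints `μ = w ± e₀, w ± e₁` of its four side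
bundles `S = (z,0)`, `E = (z+e₀,1)`, `N = (z+e₁,0)`, `W = (z,1)` (in the bundle currency
`edgeOf '' {vd | ax 2 vd ∧ tb 2 vd = t ∧ vd.2 = d}` of `Drho_eq_sum_half_pivotal_sub_defect`).  In the
frame `V a b = w + a e₀ + b e₁` the six sub-edges
`V0,-1—V1,-1` (S), `V1,-1—V1,0—V1,1` (E), `V-1,1—V0,1—V1,1` (N), `V-1,0—V-1,1` (W) form a lattice
path through the four midpoints whose drawing is connected (`frame_subedges_mem`,
`frame_centre_facts`), and no edge at the centre is axial (`centre_edge_notMem_bundleSet`).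

**Pointwise corner transfer** (`exists_setPivotal_side_of_isPivotal_two`, registered): if the spoke
`e = {w, μ}` is pivotal for the localised JOINT crossing event `Aloc m F η` in `ω` and the drawn
`w` is `r`-far (`r ≥ 20η`) from every quad side, then with `ω₀ = ω ∖ {e}` and the sides
`B₁ = S, B₂ = E, B₃ = N, B₄ = W`: for some `j ≤ 4`, `B_j` is set-pivotal at `ω₀ ∪ B₁ ∪ ⋯ ∪ B_{j−1}`.
Proof: some other spoke `{w, y}` is open (part 1); the patch `L = {wy} ∪` six sub-edges lies in
`ρ' = ω₀ ∪ B₁ ∪ B₂ ∪ B₃ ∪ B₄`, is drawn connected near `w` and contains the drawn `w`, `μ`, so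
`ρ' ∈ Aloc` (`mem_Aloc_of_local_patch`, from `ω ∪ {e} ∈ Aloc`); and `ω₀ ∉ Aloc`; the chain lemma
concludes.  No interior edge is opened, no selector is touched, every `m ≥ 1` (joint event) is
covered.  Part 3 turns this into `M(e pivotal) ≤ 585/(1−c) · Σ_{j} M(PIV_{B_j})`.
-/

noncomputable section

namespace Summit.CriticalPhenomena.CardyFormulaZ2.Theorems.CardySelfRefinement

open scoped Topology
open Filter Set MeasureTheory
open Literature.Probability.LatticeModels Literature.Probability.Percolation
open Literature.Probability.Percolation.QuadCrossing
open Summit.CriticalPhenomena.CardyFormulaZ2.Theses.CardySelfRefinement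

/-! ## The `k = 2` cell in the frame `V a b = w + a e₀ + b e₁` about its centre -/

/-- Membership criterion for the bundle currency: an axial `(a, d)` of coarse base `t` puts
`{a, a + e_d}` in the bundle of `(t, d)`. -/
theorem mem_bundleSet_of {k : ℕ} {t : Site 2} {d : Fin 2} {a b : Site 2} (hax : ax k (a, d))
    (htb : tb k (a, d) = t) (hb : b = a + dirVec d) :
    s(a, b) ∈ edgeOf '' {vd : Site 2 × Fin 2 | ax k vd ∧ tb k vd = t ∧ vd.2 = d} :=
  ⟨(a, d), ⟨hax, htb, rfl⟩, by rw [hb]⟩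

/-- **The six boundary sub-edges of the cell lie in its four side bundles.**  In the frame
`V a b = (2z + (1,1)) + a e₀ + b e₁` of the `k = 2` cell of base `z`: `V0,-1—V1,-1 ∈ S = (z,0)`,
`V1,-1—V1,0`, `V1,0—V1,1 ∈ E = (z+e₀,1)`, `V0,1—V1,1`, `V-1,1—V0,1 ∈ N = (z+e₁,0)`,
`V-1,0—V-1,1 ∈ W = (z,1)`. -/
theorem frame_subedges_mem {k : ℕ} (hk : k = 2) (z : Site 2)
    {V : ℤ → ℤ → Site 2} (hV : ∀ a b, V a b = ![(k : ℤ) * z 0 + 1, (k : ℤ) * z 1 + 1] + a • ![1, 0] + b • ![0, 1]) :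
    s(V 0 (-1), V 1 (-1)) ∈ edgeOf '' {vd : Site 2 × Fin 2 | ax k vd ∧ tb k vd = z ∧ vd.2 = 0} ∧
    s(V 1 (-1), V 1 0) ∈ edgeOf '' {vd : Site 2 × Fin 2 | ax k vd ∧ tb k vd = z + Pi.single 0 1 ∧ vd.2 = 1} ∧
    s(V 1 0, V 1 1) ∈ edgeOf '' {vd : Site 2 × Fin 2 | ax k vd ∧ tb k vd = z + Pi.single 0 1 ∧ vd.2 = 1} ∧
    s(V 0 1, V 1 1) ∈ edgeOf '' {vd : Site 2 × Fin 2 | ax k vd ∧ tb k vd = z + Pi.single 1 1 ∧ vd.2 = 0} ∧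
    s(V (-1) 1, V 0 1) ∈ edgeOf '' {vd : Site 2 × Fin 2 | ax k vd ∧ tb k vd = z + Pi.single 1 1 ∧ vd.2 = 0} ∧
    s(V (-1) 0, V (-1) 1) ∈ edgeOf '' {vd : Site 2 × Fin 2 | ax k vd ∧ tb k vd = z ∧ vd.2 = 1} := by
  subst hk
  have hdv : ∀ i : Fin 2, (dirVec i : Site 2) = Pi.single i 1 := fun i => dirVec_eq_single i
  have key : ∀ (a b : ℤ) (d : Fin 2) (t : Site 2), ((2 : ℕ) : ℤ) ∣ V a b (if d = 0 then 1 else 0) →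
      (fun i => V a b i / ((2 : ℕ) : ℤ)) = t →
      s(V a b, V a b + dirVec d) ∈ edgeOf '' {vd : Site 2 × Fin 2 | ax 2 vd ∧ tb 2 vd = t ∧ vd.2 = d} :=
    fun a b d t hax htb => mem_bundleSet_of hax htb rfl
  have hstep0 : ∀ a b : ℤ, V a b + dirVec 0 = V (a + 1) b := fun a b => by
    funext l; fin_cases l <;> simp [hV, hdv]; all_goals ring
  have hstep1 : ∀ a b : ℤ, V a b + dirVec 1 = V a (b + 1) := fun a b => by
    funext l; fin_cases l <;> simp [hV, hdv]; all_goals ring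
  refine ⟨?_, ?_, ?_, ?_, ?_, ?_⟩
  · have h := key 0 (-1) 0 z (by simp [hV]) (by funext l; fin_cases l <;> simp [hV]; all_goals omega)
    rwa [hstep0, zero_add] at h
  · have h := key 1 (-1) 1 (z + Pi.single 0 1) (by simp [hV]; omega) (by funext l; fin_cases l <;> simp [hV]; all_goals omega)
    rwa [hstep1, neg_add_cancel] at h
  · have h := key 1 0 1 (z + Pi.single 0 1) (by simp [hV]; omega) (by funext l; fin_cases l <;> simp [hV]; all_goals omega)
    rwa [hstep1, zero_add] at h
  · have h := key 0 1 0 (z + Pi.single 1 1) (by simp [hV]; omega) (by funext l; fin_cases l <;> simp [hV]; all_goals omega)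
    rwa [hstep0, zero_add] at h
  · have h := key (-1) 1 0 (z + Pi.single 1 1) (by simp [hV]; omega) (by funext l; fin_cases l <;> simp [hV]; all_goals omega)
    rwa [hstep0, neg_add_cancel] at h
  · have h := key (-1) 0 1 z (by simp [hV]) (by funext l; fin_cases l <;> simp [hV]; all_goals omega)
    rwa [hstep1, zero_add] at h

/-- **The boundary path of the cell.**  In a frame `V a b = w + a e₀ + b e₁`, the six sub-edges
`V-1,0—V-1,1—V0,1—V1,1—V1,0—V1,-1`, `V0,-1—V1,-1` have a preconnected drawing containing the drawn
lattice neighbours of the centre `V 0 0` (the four midpoints), and are lattice edges based within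
four steps of the centre. -/
theorem frame_centre_facts {w : Site 2} {V : ℤ → ℤ → Site 2}
    (hV : ∀ a b, V a b = w + a • ![1, 0] + b • ![0, 1]) (δ : ℝ) :
    IsPreconnected (openEdgeUnion δ ({s(V (-1) 0, V (-1) 1), s(V (-1) 1, V 0 1), s(V 0 1, V 1 1),
      s(V 1 1, V 1 0), s(V 1 0, V 1 (-1)), s(V 0 (-1), V 1 (-1))} : Set (Sym2 (Site 2)))) ∧
    (∀ y, (zdGraph 2).Adj (V 0 0) y → meshPoint δ y ∈ openEdgeUnion δ ({s(V (-1) 0, V (-1) 1),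
      s(V (-1) 1, V 0 1), s(V 0 1, V 1 1), s(V 1 1, V 1 0), s(V 1 0, V 1 (-1)), s(V 0 (-1), V 1 (-1))} :
        Set (Sym2 (Site 2)))) ∧
    (∀ x ∈ ({s(V (-1) 0, V (-1) 1), s(V (-1) 1, V 0 1), s(V 0 1, V 1 1),
      s(V 1 1, V 1 0), s(V 1 0, V 1 (-1)), s(V 0 (-1), V 1 (-1))} : Set (Sym2 (Site 2))),
      ∃ a b, x = s(a, b) ∧ (zdGraph 2).Adj a b ∧ ∀ i, |a i - V 0 0 i| ≤ 4) := by
  have hfr : (((![1, 0] : Site 2) = ![1, 0] ∨ (![1, 0] : Site 2) = ![-1, 0]) ∧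
      ((![0, 1] : Site 2) = ![0, 1] ∨ (![0, 1] : Site 2) = ![0, -1])) ∨
      (((![1, 0] : Site 2) = ![0, 1] ∨ (![1, 0] : Site 2) = ![0, -1]) ∧
      ((![0, 1] : Site 2) = ![1, 0] ∨ (![0, 1] : Site 2) = ![-1, 0])) := Or.inl ⟨Or.inl rfl, Or.inl rfl⟩
  have hV00 : V 0 0 = w := by rw [hV]; simp
  have hadj : ∀ {a b a' b' : ℤ}, (a' = a + 1 ∧ b' = b) ∨ (a' = a - 1 ∧ b' = b) ∨ (a' = a ∧ b' = b + 1) ∨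
      (a' = a ∧ b' = b - 1) → (zdGraph 2).Adj (V a b) (V a' b') := fun h => frame_adj hV hfr h
  refine ⟨?_, ?_, ?_⟩
  · refine isPreconnected_openEdgeUnion_insert δ (hadj (by norm_num)) ?_
      (isPreconnected_openEdgeUnion_insert δ (hadj (by norm_num)) ?_
      (isPreconnected_openEdgeUnion_insert δ (hadj (by norm_num)) ?_
      (isPreconnected_openEdgeUnion_insert δ (hadj (by norm_num)) ?_
      (isPreconnected_openEdgeUnion_insert δ (hadj (by norm_num)) ?_ ?_))))
    · exact meshPoint_mem_openEdgeUnion δ (c := V 0 1) (hadj (by norm_num)) (by simp)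
    · exact meshPoint_mem_openEdgeUnion δ (c := V 1 1) (hadj (by norm_num)) (by simp)
    · exact meshPoint_mem_openEdgeUnion δ (c := V 1 0) (hadj (by norm_num)) (by simp)
    · exact meshPoint_mem_openEdgeUnion δ (c := V 1 (-1)) (hadj (by norm_num)) (by simp)
    · exact segment_subset_openEdgeUnion' δ (x := V 0 (-1)) (y := V 1 (-1)) (hadj (by norm_num)) (by simp)
        (right_mem_segment ℝ _ _)
    · rw [openEdgeUnion_singleton_eq δ (hadj (by norm_num))]
      exact (convex_segment _ _).isPreconnected
  · intro y hy
    rcases frame_neighbours hV hfr hy with rfl | rfl | rfl | rfl <;> norm_num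
    · exact meshPoint_mem_openEdgeUnion δ (c := V 1 (-1)) (hadj (by norm_num)) (by simp)
    · exact meshPoint_mem_openEdgeUnion δ (c := V (-1) 1) (hadj (by norm_num)) (by simp)
    · exact meshPoint_mem_openEdgeUnion δ (c := V 1 1) (hadj (by norm_num)) (by simp)
    · exact meshPoint_mem_openEdgeUnion δ (c := V 1 (-1)) (hadj (by norm_num)) (by simp)
  · have hnear : ∀ a b : ℤ, |a| + |b| ≤ 4 → ∀ i, |V a b i - V 0 0 i| ≤ 4 := fun a b hab i => by
      rw [hV00]
      exact (frame_coord_le hV hfr a b i).trans hab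
    intro x hx
    simp only [Set.mem_insert_iff, Set.mem_singleton_iff] at hx
    rcases hx with rfl | rfl | rfl | rfl | rfl | rfl
    · exact ⟨_, _, rfl, hadj (by norm_num), hnear _ _ (by norm_num)⟩
    · exact ⟨_, _, rfl, hadj (by norm_num), hnear _ _ (by norm_num)⟩
    · exact ⟨_, _, rfl, hadj (by norm_num), hnear _ _ (by norm_num)⟩
    · exact ⟨_, _, rfl, hadj (by norm_num), hnear _ _ (by norm_num)⟩
    · exact ⟨_, _, rfl, hadj (by norm_num), hnear _ _ (by norm_num)⟩
    · exact ⟨_, _, rfl, hadj (by norm_num), hnear _ _ (by norm_num)⟩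

/-- **No edge at the centre of a cell is axial**: an edge `{2z + (1,1), y}` lies in no bundle (both
coordinates of the centre are odd). -/
theorem centre_edge_notMem_bundleSet {k : ℕ} (hk : k = 2) (z : Site 2) (y : Site 2) (t : Site 2) (d : Fin 2) :
    s((fun l => (k : ℤ) * z l + 1), y) ∉ edgeOf '' {vd : Site 2 × Fin 2 | ax k vd ∧ tb k vd = t ∧ vd.2 = d} := by
  subst hk
  rintro ⟨⟨v, d'⟩, ⟨hax, -, -⟩, he⟩
  have hdv : (dirVec d' : Site 2) = Pi.single d' 1 := dirVec_eq_single d'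
  have hax' : ((2 : ℕ) : ℤ) ∣ v (if d' = 0 then 1 else 0) := hax
  rcases eq_or_eq_of_sym2_eq he.symm with h | h
  · have h1 := congrFun h (if d' = 0 then 1 else 0)
    simp only at h1
    rw [← h1] at hax'
    omega
  · have h1 := congrFun h (if d' = 0 then 1 else 0)
    simp only [Pi.add_apply, hdv, Pi.single_apply] at h1
    have hne : (if d' = 0 then (1 : Fin 2) else 0) ≠ d' := by fin_cases d' <;> decide
    rw [if_neg hne, add_zero] at h1
    rw [← h1] at hax'
    omega

/-! ## The pointwise corner transfer for `k = 2` -/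

/-- **Pointwise corner transfer, `k = 2`** (registered helper of `stub_cornerLocalSlope`; the
deterministic chase of brick (B″₂)).  Let `w = 2z + (1,1)` be the centre of the cell of base `z`,
`{w, μ}` one of its four spokes, the drawn `w` at distance `≥ r ≥ 20η` from every side of every quad,
and `{w, μ}` pivotal for the localised joint crossing event `Aloc m F η` in `ω`.  Put
`ω₀ = ω ∖ {wμ}` and let `B₁, B₂, B₃, B₄` be the side bundles `(z,0)`, `(z+e₀,1)`, `(z+e₁,0)`, `(z,1)`.
Then for some `j ≤ 4` the bundle `B_j` is set-pivotal at `ω₀ ∪ B₁ ∪ ⋯ ∪ B_{j−1}`: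
`(ω₀ ∪ ⋯ ∪ B_{j−1}) ∪ B_j ∈ Aloc` and `(ω₀ ∪ ⋯ ∪ B_{j−1}) ∖ B_j ∉ Aloc` — at most three tyings, no
interior edge opened, no selector touched, any number of quads. -/
theorem exists_setPivotal_side_of_isPivotal_two : ∀ (k m : ℕ), k = 2 → ∀ (F : Fin m → Quad (Set.univ : Set ℂ)) (η r : ℝ), 0 < η → 20 * η ≤ r → ∀ (z μ : Site 2) (ω : BondConfig (Site 2)), (zdGraph 2).Adj (fun l => (k : ℤ) * z l + 1) μ → (∀ (i : Fin m) (j : Fin 4), ∀ p ∈ (F i).side j, r ≤ dist ((η : ℂ) * squareLatticeEmbedding.z (fun l => (k : ℤ) * z l + 1)) p) → IsPivotal (Aloc m F η) s((fun l => (k : ℤ) * z l + 1), μ) ω → ((ω \ {s((fun l => (k : ℤ) * z l + 1), μ)}) ∪ edgeOf '' {vd : Site 2 × Fin 2 | ax k vd ∧ tb k vd = z ∧ vd.2 = 0} ∈ Aloc m F η ∧ (ω \ {s((fun l => (k : ℤ) * z l + 1), μ)}) \ edgeOf '' {vd : Site 2 × Fin 2 | ax k vd ∧ tb k vd = z ∧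 vd.2 = 0} ∉ Aloc m F η) ∨ ((ω \ {s((fun l => (k : ℤ) * z l + 1), μ)}) ∪ edgeOf '' {vd : Site 2 × Fin 2 | ax k vd ∧ tb k vd = z ∧ vd.2 = 0} ∪ edgeOf '' {vd : Site 2 × Fin 2 | ax k vd ∧ tb k vd = z + Pi.single 0 1 ∧ vd.2 = 1} ∈ Aloc m F η ∧ ((ω \ {s((fun l => (k : ℤ) * z l + 1), μ)}) ∪ edgeOf '' {vd : Site 2 × Fin 2 | ax k vd ∧ tb k vd = z ∧ vd.2 = 0}) \ edgeOf '' {vd : Site 2 × Fin 2 | ax k vd ∧ tb k vd = z + Pi.single 0 1 ∧ vd.2 = 1} ∉ Aloc m F η) ∨ ((ω \ {s((fun l => (k : ℤ) * z l + 1), μ)}) ∪ edgeOf '' {vd : Site 2 × Fin 2 | ax k vd ∧ tb k vd = z ∧ vd.2 = 0} ∪ edgeOf '' {vd : Site 2 × Fin 2 | ax k vd ∧ tb k vd = z + Pi.single 0 1 ∧ vd.2 = 1} ∪ edgeOf '' {vd : Site 2 × Fin 2 | ax k vd ∧ tb k vd = z + Pi.single 1 1 ∧ vd.2 = 0} ∈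 Aloc m F η ∧ ((ω \ {s((fun l => (k : ℤ) * z l + 1), μ)}) ∪ edgeOf '' {vd : Site 2 × Fin 2 | ax k vd ∧ tb k vd = z ∧ vd.2 = 0} ∪ edgeOf '' {vd : Site 2 × Fin 2 | ax k vd ∧ tb k vd = z + Pi.single 0 1 ∧ vd.2 = 1}) \ edgeOf '' {vd : Site 2 × Fin 2 | ax k vd ∧ tb k vd = z + Pi.single 1 1 ∧ vd.2 = 0} ∉ Aloc m F η) ∨ ((ω \ {s((fun l => (k : ℤ) * z l + 1), μ)}) ∪ edgeOf '' {vd : Site 2 × Fin 2 | ax k vd ∧ tb k vd = z ∧ vd.2 = 0} ∪ edgeOf '' {vd : Site 2 × Fin 2 | ax k vd ∧ tb k vd = z + Pi.single 0 1 ∧ vd.2 = 1} ∪ edgeOf '' {vd : Site 2 × Fin 2 | ax k vd ∧ tb k vd = z + Pi.single 1 1 ∧ vd.2 = 0} ∪ edgeOf '' {vd : Site 2 × Fin 2 | ax k vd ∧ tb k vd = z ∧ vd.2 = 1} ∈ Aloc m F η ∧ ((ω \ {s((fun l => (k : ℤ) * z l + 1), μ)}) ∪ edgeOf '' {vd : Site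 2 × Fin 2 | ax k vd ∧ tb k vd = z ∧ vd.2 = 0} ∪ edgeOf '' {vd : Site 2 × Fin 2 | ax k vd ∧ tb k vd = z + Pi.single 0 1 ∧ vd.2 = 1} ∪ edgeOf '' {vd : Site 2 × Fin 2 | ax k vd ∧ tb k vd = z + Pi.single 1 1 ∧ vd.2 = 0}) \ edgeOf '' {vd : Site 2 × Fin 2 | ax k vd ∧ tb k vd = z ∧ vd.2 = 1} ∉ Aloc m F η) := by
  intro k m hk F η r hη hηr z μ ω hwμ hfar hpiv
  subst hk
  set w : Site 2 := fun l => ((2 : ℕ) : ℤ) * z l + 1 with hw_def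
  have hpiv' : insert s(w, μ) ω ∈ Aloc m F η ∧ ω \ {s(w, μ)} ∉ Aloc m F η := by
    rcases hpiv with ⟨ha, hb⟩ | ⟨ha, hb⟩
    · exact ⟨ha, hb⟩
    · exact absurd (isUpperSet_Aloc m F η (Set.sdiff_subset.trans (Set.subset_insert _ ω)) ha) hb
  refine setPivotal_chain4 (isUpperSet_Aloc m F η) (ω \ {s(w, μ)}) _ _ _ _ hpiv'.2 ?_
  -- the frame about the centre
  set V : ℤ → ℤ → Site 2 := fun a b => ![((2 : ℕ) : ℤ) * z 0 + 1, ((2 : ℕ) : ℤ) * z 1 + 1] + a • ![1, 0] + b • ![0, 1]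
    with hVdef
  have hV : ∀ a b, V a b = ![((2 : ℕ) : ℤ) * z 0 + 1, ((2 : ℕ) : ℤ) * z 1 + 1] + a • ![1, 0] + b • ![0, 1] :=
    fun a b => rfl
  have hwv : (![((2 : ℕ) : ℤ) * z 0 + 1, ((2 : ℕ) : ℤ) * z 1 + 1] : Site 2) = w := by
    funext l; fin_cases l <;> simp [hw_def]
  have hV' : ∀ a b, V a b = w + a • ![1, 0] + b • ![0, 1] := fun a b => by rw [hV, hwv]
  have hV00 : V 0 0 = w := by rw [hV']; simp
  obtain ⟨hmem1, hmem2, hmem3, hmem4, hmem5, hmem6⟩ := frame_subedges_mem rfl z hV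
  obtain ⟨hconn, hmid, hnear⟩ := frame_centre_facts hV' (η * Real.sqrt 2)
  rw [hV00] at hmid hnear
  -- an open spoke, and the patch
  obtain ⟨y, hwy, hyω, hyμ⟩ := exists_adj_mem_of_isPivotal m F hη (by linarith) hwμ hfar hpiv
  refine mem_Aloc_of_local_patch m F hη hηr hwμ hfar (ρ := insert s(w, μ) ω)
    (L := insert s(w, y) ({s(V (-1) 0, V (-1) 1), s(V (-1) 1, V 0 1), s(V 0 1, V 1 1),
      s(V 1 1, V 1 0), s(V 1 0, V 1 (-1)), s(V 0 (-1), V 1 (-1))} : Set (Sym2 (Site 2))))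
    ?_ ?_ ?_ ?_ (isPreconnected_openEdgeUnion_insert _ hwy (hmid y hwy) hconn)
    (meshPoint_mem_openEdgeUnion _ hwy (Set.mem_insert _ _))
    (openEdgeUnion_mono _ (Set.subset_insert _ _) (hmid μ hwμ)) hpiv'.1
  · -- `ω ∪ {e} ⊆ ρ' ∪ {e}`
    intro x hx
    rcases Set.mem_insert_iff.1 hx with rfl | hxω
    · exact Or.inr rfl
    · by_cases hxe : x = s(w, μ)
      · exact Or.inr hxe
      · exact Or.inl (Or.inl (Or.inl (Or.inl (Or.inl ⟨hxω, hxe⟩))))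
  · -- `e ∉ ρ'`: not in `ω₀`, and no edge at the centre is axial
    rintro ((((⟨-, h⟩ | h) | h) | h) | h)
    · exact h rfl
    · exact centre_edge_notMem_bundleSet rfl z μ _ _ h
    · exact centre_edge_notMem_bundleSet rfl z μ _ _ h
    · exact centre_edge_notMem_bundleSet rfl z μ _ _ h
    · exact centre_edge_notMem_bundleSet rfl z μ _ _ h
  · -- the patch lies in `ρ'`
    intro x hx
    rcases Set.mem_insert_iff.1 hx with rfl | hx6
    · exact Or.inl (Or.inl (Or.inl (Or.inl ⟨hyω, fun h => hyμ (Sym2.congr_right.1 h)⟩)))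
    · simp only [Set.mem_insert_iff, Set.mem_singleton_iff] at hx6
      rcases hx6 with rfl | rfl | rfl | rfl | rfl | rfl
      · exact Or.inr hmem6
      · exact Or.inl (Or.inr hmem5)
      · exact Or.inl (Or.inr hmem4)
      · exact Or.inl (Or.inl (Or.inr (by rw [Sym2.eq_swap]; exact hmem3)))
      · exact Or.inl (Or.inl (Or.inr (by rw [Sym2.eq_swap]; exact hmem2)))
      · exact Or.inl (Or.inl (Or.inl (Or.inr hmem1)))
  · -- the patch is based near the centre
    intro x hx
    rcases Set.mem_insert_iff.1 hx with rfl | hx6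
    · exact ⟨w, y, rfl, hwy, fun i => by simp⟩
    · exact hnear x hx6

end Summit.CriticalPhenomena.CardyFormulaZ2.Theorems.CardySelfRefinement

end
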